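import Literature.NumberTheory.CubicFields.ShintaniZeta
import Literature.NumberTheory.CubicFields.StabilizerFiniteReducible
import HarnessLib

/-!
# The Shintani coefficients are positive exactly where there are forms: `a(D) > 0 ⇔ h(D) > 0`

Topic `Literature/NumberTheory/CubicFields`; a complement to `ShintaniZeta.lean` (`a(D) = Σ_{orbits of
disc D} 1/|Stab|`, `0 ≤ a(D) ≤ h(D)`) using `StabilizerFiniteReducible.lean` (the stabilizer of every
nondegenerate form is finite, so `1 ≤ |Stab(f)|` and each weight `1/|Stab(f)|` is a positive real).

Bhargava–Taniguchi–Thorne 2023, §2.4 (11): the Dirichlet coefficients `a^±(n)` of Shintani's zeta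
functions are sums of the positive weights `|Stab(x)|⁻¹` over the `h(±n)` orbits of discriminant
`±n`. Here, for `D ≠ 0`:

* `one_le_stabCard_of_disc_ne_zero`, `stabCard_pos` — `1 ≤ |Stab(f)|` whenever `Disc f ≠ 0`;
* `shintaniCoeffWith_one_eq_sum` — `a(D) = Σ_{O} 1/|Stab(rep O)|` as a real finite sum (for `D ≠ 0`, with every
  term in `(0, 1]`);
* **`shintaniCoeffWith_one_pos_iff`** — `a(D) > 0 ⇔ h(D) > 0 ⇔` there is a form of discriminant `D`;
  `shintaniCoeffWith_one_eq_zero_iff` — `a(D) = 0 ⇔ h(D) = 0`.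

## References

* M. Bhargava, T. Taniguchi, F. Thorne, *Improved error estimates for the Davenport–Heilbronn
  theorems*, Math. Ann. 389 (2024) = arXiv:2107.12819, §2.4 (11) [BhargavaTaniguchiThorne2023].
-/

namespace Literature.NumberTheory.CubicFields

open BinaryCubic RingOfForm

/-- `1 ≤ |Stab(f)|` for every nondegenerate `f` (the stabilizer is finite and contains `1`). [folklore] -/
theorem one_le_stabCard_of_disc_ne_zero {f : BinaryCubic ℤ} (h0 : f.disc ≠ 0) : 1 ≤ stabCard f :=
  one_le_card_stabilizer_of_disc_ne_zero h0

/-- `0 < |Stab(f)|` as a real number, for `Disc f ≠ 0`. [folklore] -/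
theorem stabCard_pos {f : BinaryCubic ℤ} (h0 : f.disc ≠ 0) : (0 : ℝ) < stabCard f := by
  exact_mod_cast one_le_stabCard_of_disc_ne_zero h0

/-- The representative of an orbit of discriminant `D ≠ 0` is nondegenerate. [folklore] -/
theorem disc_orbitRep_ne_zero {D : ℤ} (hD : D ≠ 0) (O : orbitsOfDisc D) : (orbitRep O).disc ≠ 0 := by
  rw [(orbitRep_spec O).2]; exact hD

/-- **`a(D)` as an honest finite sum of positive weights** (for `D ≠ 0`). [folklore] -/
theorem shintaniCoeffWith_one_eq_sum {D : ℤ} [Fintype (orbitsOfDisc D)] :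
    shintaniCoeffWith (fun _ => 1) D = ((∑ O : orbitsOfDisc D, ((stabCard (orbitRep O) : ℝ))⁻¹ : ℝ) : ℂ) := by
  rw [shintaniCoeffWith_one, finsum_eq_sum_of_fintype]
  push_cast
  rfl

/-- **`a(D) > 0` iff there is an integral binary cubic form of discriminant `D`** (`D ≠ 0`): every
orbit contributes the positive weight `1/|Stab|`. [cite: BhargavaTaniguchiThorne2023, §2.4 (11) (a^±(n) > 0 exactly when h(±n) > 0)] -/
theorem shintaniCoeffWith_one_pos_iff {D : ℤ} (hD : D ≠ 0) :
    (∃ r : ℝ, shintaniCoeffWith (fun _ => 1) D = r ∧ 0 < r) ↔ ∃ f : BinaryCubic ℤ, f.disc = D := by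
  haveI := finite_orbitsOfDisc hD
  haveI : Fintype (orbitsOfDisc D) := Fintype.ofFinite _
  rw [shintaniCoeffWith_one_eq_sum]
  constructor
  · rintro ⟨r, hr, hpos⟩
    have hr' : (∑ O : orbitsOfDisc D, ((stabCard (orbitRep O) : ℝ))⁻¹) = r := by exact_mod_cast hr
    rw [← hr'] at hpos
    by_contra hno
    push Not at hno
    haveI : IsEmpty (orbitsOfDisc D) := ⟨fun ⟨O, f, _, hf⟩ => hno f hf⟩
    rw [Finset.univ_eq_empty, Finset.sum_empty] at hpos
    exact lt_irrefl _ hpos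
  · rintro ⟨f, hf⟩
    refine ⟨∑ O : orbitsOfDisc D, ((stabCard (orbitRep O) : ℝ))⁻¹, rfl, ?_⟩
    have hO : (⟨gl2zOrbit f, f, rfl, hf⟩ : orbitsOfDisc D) ∈ Finset.univ := Finset.mem_univ _
    exact Finset.sum_pos' (fun O _ => le_of_lt (inv_pos.mpr (stabCard_pos (disc_orbitRep_ne_zero hD O))))
      ⟨_, hO, inv_pos.mpr (stabCard_pos (disc_orbitRep_ne_zero hD _))⟩

/-- Equivalently `a(D) > 0 ⇔ h(D) > 0` (`D ≠ 0`). [folklore] -/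
theorem shintaniCoeffWith_one_pos_iff_classNumber_pos {D : ℤ} (hD : D ≠ 0) :
    (∃ r : ℝ, shintaniCoeffWith (fun _ => 1) D = r ∧ 0 < r) ↔ 0 < classNumber D := by
  haveI := finite_orbitsOfDisc hD
  rw [shintaniCoeffWith_one_pos_iff hD, classNumber, Nat.card_pos_iff]
  constructor
  · rintro ⟨f, hf⟩
    exact ⟨⟨⟨gl2zOrbit f, f, rfl, hf⟩⟩, inferInstance⟩
  · rintro ⟨⟨⟨O, f, hO, hf⟩⟩, -⟩
    exact ⟨f, hf⟩

/-- **`a(D) = 0` iff `h(D) = 0`** (`D ≠ 0`). [folklore] -/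
theorem shintaniCoeffWith_one_eq_zero_iff {D : ℤ} (hD : D ≠ 0) :
    shintaniCoeffWith (fun _ => 1) D = 0 ↔ classNumber D = 0 := by
  haveI := finite_orbitsOfDisc hD
  haveI : Fintype (orbitsOfDisc D) := Fintype.ofFinite _
  constructor
  · intro h0
    by_contra hne
    have hpos : 0 < classNumber D := Nat.pos_of_ne_zero hne
    obtain ⟨r, hr, hrpos⟩ := (shintaniCoeffWith_one_pos_iff_classNumber_pos hD).mpr hpos
    rw [h0] at hr
    have : (r : ℂ) = 0 := hr.symm
    have : r = 0 := by exact_mod_cast this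
    linarith
  · intro h0
    haveI : IsEmpty (orbitsOfDisc D) := by
      rw [classNumber, Nat.card_eq_fintype_card, Fintype.card_eq_zero_iff] at h0
      exact h0
    rw [shintaniCoeffWith, finsum_of_isEmpty]

end Literature.NumberTheory.CubicFields
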